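import Literature.IUT.HodgeTheaters.GlobalFrobenioidsCoricModel
import Literature.IUT.HodgeTheaters.GlobalFrobenioidsCoricRigidityIndependence
import Literature.IUT.HodgeTheaters.GlobalFrobenioidsCyclotomeRigidityZHat
import Literature.IUT.HodgeTheaters.KappaCoricFunctionsExistence
import HarnessLib

/-!
# [IUTchI] Example 5.1 (v), pp. 127–128: "unique up to a uniquely determined isomorphism" DERIVED from
# Kummer naturality + divisors of `κ`-coric functions + `ℚ_{>0} ∩ Ẑ^× = {1}` (proof-only)

S. Mochizuki, *Inter-universal Teichmüller theory I*, kurims manuscript (May 2020), §5, Example 5.1 (v),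
p. 127 l. 76 – p. 128 l. 24 and p. 128 l. 49–54 ([IUTchI] Ex 5.1 (v) pp.127–128) [claim: Mochizuki2012,
status: disputed]: "it follows immediately, by considering divisors of zeroes and poles [cf. the definition of
a "`κ`-coric function" given in Remark 3.1.7, (i)] associated to Kummer classes of rational functions as in
[AbsTopIII], Proposition 1.6, (iii), from the elementary observation that, relative to the natural inclusion
`ℚ ↪ Ẑ ⊗ ℚ`, `ℚ_{>0} ∩ Ẑ^× = {1}`, that there exists a unique isomorphism of cyclotomes
`μ^Θ_Ẑ(π₁(†𝒟^⊚)) ⥲ μ_Ẑ(†𝕄^⊛_∞κ)` … In particular, … `†ℱ^⊛` always admits an ∞κ-coric (respectively,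
∞κ×-coric) structure, which is, moreover, unique up to a uniquely determined isomorphism".

Sub-DAG `plan/L5/SUBDAG-IUTchI-Ex51.md` rows E51/L27 (a)+(b′) ⇒ E51/L29; GAP-LEDGER G-w4d056-2 (node
IUTchI:Ex5.1(v)).  PROOF-ONLY: theorems, no definition, no new `Prop` fact; every printed input that the typed
Example-5.1 interface does not carry is an EXPLICIT HYPOTHESIS of the theorems, stated in the tree's REAL
vocabulary (`Ẑ^× = MulAut Ẑ` over Mathlib's profinite completion, `ZHatLevel.eta : ℤ → Ẑ`).

**State of the row before this file.**  abc-iut-L5-t1 typed the boxed display as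
`ExistsUniqueCoricStructure Γ model` (`GlobalFrobenioidsKummer.lean`); abc-iut-w5-d110 reduced it to KUMMER
RIGIDITY of the model pair, `hrigid : ∀ e : CoricPair.Iso model model, e.IsCompatible κ κ`
(`existsUniqueCoricStructure_of_kummerRigid`, `GlobalFrobenioidsCoricModel.lean`), EQUIVALENT to the typed
uniqueness (`existsUniqueCoricStructure_iff_kummerRigid`, abc-iut-w4-d056 gen 0), and UNPROVABLE from the
Example-5.1 (i) interface plus Kummer realisations alone (`NFBridgeRecon.exists_recon_not_existsUniqueCoricStructure`:
the witness carries the automorphism `f ↦ f⁻¹`); the number theory "`ℚ_{>0} ∩ Ẑ^× = {1}`" is in the tree for the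
REAL `Ẑ^×` (`CyclotomeRigidity.eq_one_of_two_zeros_one_pole`, abc-iut-w4-d056 gen 2, over abc-iut-w5-d110's
exponent engine and abc-iut-w4-d024's `ZHatLevelDetermination`).

**What this file proves** (`CoricPair.kummerRigid_of_divisors` and corollaries): `hrigid` — hence
`ExistsUniqueCoricStructure` — FOLLOWS from the three printed inputs, each bound as a hypothesis:
* (a) KUMMER NATURALITY `hnat`: every automorphism `e` of the pair acts on Kummer classes through SOME
  `u_e ∈ Ẑ^× = Aut(μ_Ẑ(−))` acting on the Kummer container: `κ(e x) = u_e • κ(x)` [functoriality of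
  `M ↦ lim_H H¹(H, μ_Ẑ(M))` in automorphisms of the cyclotomic pseudo-monoid `M`; the typed
  `CoricPair.KummerRealization` is free data and carries no such law];
* (b′) DIVISORS `hord` ([AbsTopIII] Prop. 1.6 (iii) "divisors of zeroes and poles associated to Kummer classes of
  rational functions"): the `N`-invariant elements of the pair [the genuine rational functions: for the model
  ∞κ-pair and `N = π₁^rat`, exactly the `κ`-coric functions `𝕄^⊛_κ`, `NFBridgeRecon.mem_infκPair_fixedSub_top_iff`]
  have INTEGER orders `ord x f ∈ ℤ` at points `x`, on which `Ẑ^×` acts by multiplication: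
  `κ(f′) = u • κ(f)` forces `u(η(ord_x f)) = η(ord_x f′)` in `Ẑ`;
* Remark 3.1.7 (i) p. 67 in divisor form: an invariant [`κ`-coric] element has AT MOST ONE POLE ("whenever
  `f ∉ L` … precisely one pole [of unrestricted order], but at least two distinct zeroes"; constants have none) —
  `hpole`; and SOME invariant element has two distinct zeroes — `hex` (a non-constant `κ`-coric function exists,
  Rmk 3.1.7 (ii) p. 67: "there exists a `κ`-coric `f_sol ∈ L_C` of degree 4").
The logic: `e` preserves `N`-invariants (equivariance, abc-iut-w5-d110's `Iso.apply_mem_fixedSub_iff`), so `f` and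
`f′ := e(f)` both have integer divisors; (a)+(b′) give `u_e(η dᵢ) = η dᵢ′` at the two zeroes of `f`; `hpole` for
`f′` says `d₁′, d₂′` are not both negative; "`ℚ_{>0} ∩ Ẑ^× = {1}`" (`eq_one_of_two_zeros_one_pole`) gives `u_e = 1`;
hence `κ(e x) = κ(x)`.  The residual of rows E51/L27–L29 is thereby EXACTLY the instantiation of `hnat`/`hord`/
`hpole`/`hex` at the genuine Kummer map (L2 `KummerMap` ↔ `KummerRealization` merge, [AbsTopIII] Prop. 1.6 (iii),
Rmk 3.1.7 (i) at abc-iut-L5-t2's `CriticalLocus.IsKappaCoric`) — no further logic.  No side is taken on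
[IUTchIII] Cor. 3.12; nothing of the disputed series is asserted; typed ≠ proved.
-/

namespace Literature.IUT.HodgeTheaters

open ProfiniteGrp ProfiniteGrp.ProfiniteCompletion
open Literature.AnabelianGeometry.EtaleTheta Literature.AnabelianGeometry.EtaleTheta.ZHatLevel

universe u

/-! ### The abstract derivation: Kummer rigidity of a pair from naturality + divisors -/

section Abstract

variable {Γ : Type u} [Group Γ] [TopologicalSpace Γ]

namespace CoricPair

variable {P : CoricPair Γ} {H : Type u} [CommGroup H] [MulAction Γ H]
  [MulAction (MulAut (completion (GrpCat.of (Multiplicative ℤ)))) H]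

/-- **The `Ẑ^×`-multiplier of an automorphism is trivial** ([IUTchI] Ex. 5.1 (v) p. 127 l. 76 – p. 128 l. 2:
"by considering divisors of zeroes and poles … from the elementary observation `ℚ_{>0} ∩ Ẑ^× = {1}`").  Let
`Γ ↷ P` be a pair with Kummer realisation `κ` in a container `H` on which `Ẑ^× = Aut(Ẑ)` acts, `N ⊴ Γ`, and
`ord x : P → ℤ` "orders at the points `x`" subject to: (b′) `hord` — for `N`-invariant `f, f′` with
`κ(f′) = u • κ(f)`, `u(η(ord_x f)) = η(ord_x f′)` at every `x`; Rmk 3.1.7 (i) — `hpole`: an `N`-invariant element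
does not have poles at two distinct points.  If an automorphism `e` of the pair acts on Kummer classes through
`u ∈ Ẑ^×` [`κ(e x) = u • κ(x)`] and some `N`-invariant `f` has zeroes (positive order) at two distinct points, then
`u = 1` in `Aut(Ẑ)`.  PROVED (engine: `CyclotomeRigidity.eq_one_of_two_zeros_one_pole`).
([IUTchI] Ex 5.1 (v) p.127) [claim: Mochizuki2012, status: disputed] -/
theorem multiplier_eq_one_of_divisors (κ : P.KummerRealization H) (N : Subgroup Γ) [N.Normal]
    {X : Type*} (ord : X → P.carrier → ℤ)
    (hord : ∀ (u : MulAut (completion (GrpCat.of (Multiplicative ℤ)))) (f f' : P.carrier),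
      f ∈ P.fixedSub N → f' ∈ P.fixedSub N → κ.toFun f' = u • κ.toFun f →
      ∀ x : X, u (eta (ord x f)) = eta (ord x f'))
    (hpole : ∀ f' : P.carrier, f' ∈ P.fixedSub N → ∀ x₁ x₂ : X, x₁ ≠ x₂ →
      ¬ (ord x₁ f' < 0 ∧ ord x₂ f' < 0))
    (e : Iso P P) (u : MulAut (completion (GrpCat.of (Multiplicative ℤ))))
    (hu : ∀ x : P.carrier, κ.toFun (e.toEquiv x) = u • κ.toFun x)
    {f : P.carrier} (hf : f ∈ P.fixedSub N) {x₁ x₂ : X} (hx : x₁ ≠ x₂)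
    (h₁ : 0 < ord x₁ f) (h₂ : 0 < ord x₂ f) : u = 1 := by
  -- `f′ := e(f)` is again `N`-invariant (equivariance of `e`)
  have hf' : e.toEquiv f ∈ P.fixedSub N := (e.apply_mem_fixedSub_iff N f).mpr hf
  -- the divisor relations `u(η dᵢ) = η dᵢ′` at the two zeroes of `f`
  have hrel := hord u f (e.toEquiv f) hf hf' (hu f)
  exact CyclotomeRigidity.eq_one_of_two_zeros_one_pole u h₁ h₂ (hpole _ hf' x₁ x₂ hx) (hrel x₁) (hrel x₂)

/-- **Kummer rigidity of a pair from its printed inputs** ([IUTchI] Ex. 5.1 (v) pp. 127–128).  For a pair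
`Γ ↷ P` with Kummer realisation `κ : P ↪ H`, `Ẑ^×` acting on the container `H`, `N ⊴ Γ` and orders
`ord x : P → ℤ`, assume: (a) `hnat` — every automorphism of the pair acts on Kummer classes through some
`u ∈ Ẑ^×` [naturality of the Kummer map, `Aut(μ_Ẑ(−)) = Ẑ^×`]; (b′) `hord` — `Ẑ^×` acts on the integer divisors of
`N`-invariant elements by multiplication ([AbsTopIII] Prop. 1.6 (iii)); Rmk 3.1.7 (i) — `hpole` (an `N`-invariant
element has at most one pole) and `hex` (some `N`-invariant element has at least two distinct zeroes).  THEN every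
automorphism of the pair is compatible with `κ` — abc-iut-w5-d110's hypothesis `hrigid` of
`existsUniqueCoricStructure_of_kummerRigid`.  PROVED. ([IUTchI] Ex 5.1 (v) p.128)
[claim: Mochizuki2012, status: disputed] -/
theorem kummerRigid_of_divisors (κ : P.KummerRealization H) (N : Subgroup Γ) [N.Normal]
    (hnat : ∀ e : Iso P P, ∃ u : MulAut (completion (GrpCat.of (Multiplicative ℤ))),
      ∀ x : P.carrier, κ.toFun (e.toEquiv x) = u • κ.toFun x)
    {X : Type*} (ord : X → P.carrier → ℤ)
    (hord : ∀ (u : MulAut (completion (GrpCat.of (Multiplicative ℤ)))) (f f' : P.carrier),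
      f ∈ P.fixedSub N → f' ∈ P.fixedSub N → κ.toFun f' = u • κ.toFun f →
      ∀ x : X, u (eta (ord x f)) = eta (ord x f'))
    (hpole : ∀ f' : P.carrier, f' ∈ P.fixedSub N → ∀ x₁ x₂ : X, x₁ ≠ x₂ →
      ¬ (ord x₁ f' < 0 ∧ ord x₂ f' < 0))
    (hex : ∃ f : P.carrier, f ∈ P.fixedSub N ∧ ∃ x₁ x₂ : X, x₁ ≠ x₂ ∧ 0 < ord x₁ f ∧ 0 < ord x₂ f) :
    ∀ e : Iso P P, e.IsCompatible κ κ := by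
  intro e x
  obtain ⟨u, hu⟩ := hnat e
  obtain ⟨f, hf, x₁, x₂, hx, h₁, h₂⟩ := hex
  have hu1 : u = 1 := multiplier_eq_one_of_divisors κ N ord hord hpole e u hu hf hx h₁ h₂
  change κ.toFun (e.toEquiv x) = κ.toFun x
  rw [hu x, hu1, one_smul]

/-- Hence the pair is RIGID: it has no automorphism other than the identity (injectivity of `κ`,
abc-iut-L5-t12's `Iso.eq_of_isCompatible`). ([IUTchI] Ex 5.1 (v) p.128) [claim: Mochizuki2012, status: disputed] -/
theorem subsingleton_iso_of_divisors (κ : P.KummerRealization H) (N : Subgroup Γ) [N.Normal]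
    (hnat : ∀ e : Iso P P, ∃ u : MulAut (completion (GrpCat.of (Multiplicative ℤ))),
      ∀ x : P.carrier, κ.toFun (e.toEquiv x) = u • κ.toFun x)
    {X : Type*} (ord : X → P.carrier → ℤ)
    (hord : ∀ (u : MulAut (completion (GrpCat.of (Multiplicative ℤ)))) (f f' : P.carrier),
      f ∈ P.fixedSub N → f' ∈ P.fixedSub N → κ.toFun f' = u • κ.toFun f →
      ∀ x : X, u (eta (ord x f)) = eta (ord x f'))
    (hpole : ∀ f' : P.carrier, f' ∈ P.fixedSub N → ∀ x₁ x₂ : X, x₁ ≠ x₂ →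
      ¬ (ord x₁ f' < 0 ∧ ord x₂ f' < 0))
    (hex : ∃ f : P.carrier, f ∈ P.fixedSub N ∧ ∃ x₁ x₂ : X, x₁ ≠ x₂ ∧ 0 < ord x₁ f ∧ 0 < ord x₂ f) :
    Subsingleton (Iso P P) :=
  (kummerRigid_iff_subsingleton_iso κ).mp (kummerRigid_of_divisors κ N hnat ord hord hpole hex)

end CoricPair

/-- **Ex. 5.1 (v), p. 128, boxed display, DERIVED**: "`†ℱ^⊛` always admits an ∞κ-coric (respectively,
∞κ×-coric) structure, which is, moreover, unique up to a uniquely determined isomorphism" — abc-iut-L5-t1's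
`ExistsUniqueCoricStructure Γ model` follows, for ANY model pair realised by a Kummer map `κ` in a container with
`Ẑ^×`-action, from (a) Kummer naturality `hnat`, (b′) integer divisors of the `N`-invariant elements with
`Ẑ^×` acting by multiplication `hord`, and Rmk 3.1.7 (i)'s pole/zero shape `hpole`/`hex`.  PROVED (composition of
`CoricPair.kummerRigid_of_divisors` with abc-iut-w5-d110's `existsUniqueCoricStructure_of_kummerRigid`).
([IUTchI] Ex 5.1 (v) p.128) [claim: Mochizuki2012, status: disputed] -/
theorem existsUniqueCoricStructure_of_divisors {model : CoricPair Γ} {H : Type u} [CommGroup H]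
    [MulAction Γ H] [MulAction (MulAut (completion (GrpCat.of (Multiplicative ℤ)))) H]
    (κ : model.KummerRealization H) (N : Subgroup Γ) [N.Normal]
    (hnat : ∀ e : CoricPair.Iso model model, ∃ u : MulAut (completion (GrpCat.of (Multiplicative ℤ))),
      ∀ x : model.carrier, κ.toFun (e.toEquiv x) = u • κ.toFun x)
    {X : Type*} (ord : X → model.carrier → ℤ)
    (hord : ∀ (u : MulAut (completion (GrpCat.of (Multiplicative ℤ)))) (f f' : model.carrier),
      f ∈ model.fixedSub N → f' ∈ model.fixedSub N → κ.toFun f' = u • κ.toFun f →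
      ∀ x : X, u (eta (ord x f)) = eta (ord x f'))
    (hpole : ∀ f' : model.carrier, f' ∈ model.fixedSub N → ∀ x₁ x₂ : X, x₁ ≠ x₂ →
      ¬ (ord x₁ f' < 0 ∧ ord x₂ f' < 0))
    (hex : ∃ f : model.carrier, f ∈ model.fixedSub N ∧
      ∃ x₁ x₂ : X, x₁ ≠ x₂ ∧ 0 < ord x₁ f ∧ 0 < ord x₂ f) :
    ExistsUniqueCoricStructure Γ model :=
  existsUniqueCoricStructure_of_kummerRigid κ
    (CoricPair.kummerRigid_of_divisors κ N hnat ord hord hpole hex)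

end Abstract

/-! ### The MODEL pairs of (i)/(v): `π₁^rat(†𝒟^⊛) ↷ 𝕄^⊛_∞κ(†𝒟^⊚)` and `𝕄^⊛_∞κ×(†𝒟^⊚)` -/

namespace NFBridgeRecon

variable (N : NFBridgeRecon.{u})

/-- **Ex. 5.1 (v) for the model ∞κ-pair**, with the divisor data on the `κ`-CORIC FUNCTIONS `𝕄^⊛_κ(†𝒟^⊚)`
[= the `π₁^rat`-invariants of `𝕄^⊛_∞κ`, p. 124, abc-iut-L5-t1's `MκIsInvariants`]: given a Kummer realisation
`κ` of `π₁^rat(†𝒟^⊛) ↷ 𝕄^⊛_∞κ(†𝒟^⊚)` in a container with `Ẑ^×`-action satisfying (a) naturality `hnat`, orders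
`ord x : K^rat → ℤ` at points `x` such that (b′) for `κ`-coric `f, f′` with `κ(f′) = u • κ(f)` one has
`u(η(ord_x f)) = η(ord_x f′)` ([AbsTopIII] Prop. 1.6 (iii)), and Rmk 3.1.7 (i): a `κ`-coric function has at most
one pole (`hpole`) and some `κ`-coric function has two distinct zeroes (`hex`, Rmk 3.1.7 (ii) `f_sol`) — THEN
`ExistsUniqueCoricStructure π₁^rat 𝕄^⊛_∞κ(†𝒟^⊚)`: the ∞κ-coric structure is "unique up to a uniquely determined
isomorphism" (p. 128).  PROVED. ([IUTchI] Ex 5.1 (v) p.128) [claim: Mochizuki2012, status: disputed] -/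
theorem existsUniqueCoricStructure_infκPair_of_divisors (hκ : N.MκIsInvariants) {H : Type u} [CommGroup H]
    [MulAction N.piRat H] [MulAction (MulAut (completion (GrpCat.of (Multiplicative ℤ)))) H]
    (κ : N.infκPair.KummerRealization H)
    (hnat : ∀ e : CoricPair.Iso N.infκPair N.infκPair,
      ∃ u : MulAut (completion (GrpCat.of (Multiplicative ℤ))),
        ∀ x : N.infκPair.carrier, κ.toFun (e.toEquiv x) = u • κ.toFun x)
    {X : Type*} (ord : X → N.Krat → ℤ)
    (hord : ∀ (u : MulAut (completion (GrpCat.of (Multiplicative ℤ)))) (f f' : N.infκPair.carrier),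
      (f : N.Krat) ∈ N.Mκ → (f' : N.Krat) ∈ N.Mκ → κ.toFun f' = u • κ.toFun f →
      ∀ x : X, u (eta (ord x f)) = eta (ord x f'))
    (hpole : ∀ f' ∈ N.Mκ, ∀ x₁ x₂ : X, x₁ ≠ x₂ → ¬ (ord x₁ f' < 0 ∧ ord x₂ f' < 0))
    (hex : ∃ f ∈ N.Mκ, ∃ x₁ x₂ : X, x₁ ≠ x₂ ∧ 0 < ord x₁ f ∧ 0 < ord x₂ f) :
    ExistsUniqueCoricStructure N.piRat N.infκPair := by
  refine existsUniqueCoricStructure_of_divisors κ ⊤ hnat (fun x (f : N.infκPair.carrier) => ord x (f : N.Krat))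
    ?_ ?_ ?_
  · intro u f f' hf hf' h x
    exact hord u f f' ((N.mem_infκPair_fixedSub_top_iff hκ f).mp hf)
      ((N.mem_infκPair_fixedSub_top_iff hκ f').mp hf') h x
  · intro f' hf' x₁ x₂ hx
    exact hpole _ ((N.mem_infκPair_fixedSub_top_iff hκ f').mp hf') x₁ x₂ hx
  · obtain ⟨f, hf, x₁, x₂, hx, h₁, h₂⟩ := hex
    exact ⟨⟨f, N.mκ_subset hf⟩, (N.mem_infκPair_fixedSub_top_iff hκ _).mpr hf, x₁, x₂, hx, h₁, h₂⟩

/-- The `π₁^rat(†𝒟^⊛)`-invariants of the model ∞κ×-pair are the ∞κ×-coric functions FIXED by `π₁^rat` [the ones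
lying in the function field `L_C` itself — genuine rational functions: a unit constant times an element whose power
is `κ`-coric, Rmk 3.1.7 (ii)], unfolded. ([IUTchI] Ex 5.1 (v) p.128) [claim: Mochizuki2012, status: disputed] -/
theorem mem_infκxPair_fixedSub_top_iff (x : N.infκxPair.carrier) :
    x ∈ N.infκxPair.fixedSub ⊤ ↔ ∀ g : N.piRat, g • (x : N.Krat) = x := by
  rw [CoricPair.mem_fixedSub_iff]
  constructor
  · intro h g
    exact congrArg (fun y : N.infκxPair.carrier => (y : N.Krat)) (h g trivial)
  · intro h g _
    exact Subtype.ext (h g)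

/-- **Ex. 5.1 (v) for the model ∞κ×-pair** ("respectively, ∞κ×-coric"): the same derivation with the divisor data
on the `π₁^rat`-invariant ∞κ×-coric functions [genuine rational functions `c·g`, `c ∈ U_L`, `gⁿ` `κ`-coric — integer
divisors, at most one pole (that of `g`); the `κ`-coric `f_sol` is among them, `𝕄^⊛_κ ⊆ 𝕄^⊛_∞κ ⊆ 𝕄^⊛_∞κ×`] gives
`ExistsUniqueCoricStructure π₁^rat 𝕄^⊛_∞κ×(†𝒟^⊚)`.  PROVED. ([IUTchI] Ex 5.1 (v) p.128)
[claim: Mochizuki2012, status: disputed] -/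
theorem existsUniqueCoricStructure_infκxPair_of_divisors {H : Type u} [CommGroup H]
    [MulAction N.piRat H] [MulAction (MulAut (completion (GrpCat.of (Multiplicative ℤ)))) H]
    (κ : N.infκxPair.KummerRealization H)
    (hnat : ∀ e : CoricPair.Iso N.infκxPair N.infκxPair,
      ∃ u : MulAut (completion (GrpCat.of (Multiplicative ℤ))),
        ∀ x : N.infκxPair.carrier, κ.toFun (e.toEquiv x) = u • κ.toFun x)
    {X : Type*} (ord : X → N.Krat → ℤ)
    (hord : ∀ (u : MulAut (completion (GrpCat.of (Multiplicative ℤ)))) (f f' : N.infκxPair.carrier),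
      (∀ g : N.piRat, g • (f : N.Krat) = f) → (∀ g : N.piRat, g • (f' : N.Krat) = f') →
      κ.toFun f' = u • κ.toFun f → ∀ x : X, u (eta (ord x f)) = eta (ord x f'))
    (hpole : ∀ f' ∈ N.Minfκx, (∀ g : N.piRat, g • f' = f') →
      ∀ x₁ x₂ : X, x₁ ≠ x₂ → ¬ (ord x₁ f' < 0 ∧ ord x₂ f' < 0))
    (hex : ∃ f ∈ N.Minfκx, (∀ g : N.piRat, g • f = f) ∧
      ∃ x₁ x₂ : X, x₁ ≠ x₂ ∧ 0 < ord x₁ f ∧ 0 < ord x₂ f) :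
    ExistsUniqueCoricStructure N.piRat N.infκxPair := by
  refine existsUniqueCoricStructure_of_divisors κ ⊤ hnat (fun x (f : N.infκxPair.carrier) => ord x (f : N.Krat))
    ?_ ?_ ?_
  · intro u f f' hf hf' h x
    exact hord u f f' ((N.mem_infκxPair_fixedSub_top_iff f).mp hf)
      ((N.mem_infκxPair_fixedSub_top_iff f').mp hf') h x
  · intro f' hf' x₁ x₂ hx
    exact hpole _ f'.2 ((N.mem_infκxPair_fixedSub_top_iff f').mp hf') x₁ x₂ hx
  · obtain ⟨f, hf, hfix, x₁, x₂, hx, h₁, h₂⟩ := hex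
    exact ⟨⟨f, hf⟩, (N.mem_infκxPair_fixedSub_top_iff _).mpr hfix, x₁, x₂, hx, h₁, h₂⟩

end NFBridgeRecon

/-! ### Remark 3.1.7 (i) in divisor form, at abc-iut-L5-t2's REAL typing (`RatFunc Ω`, `CriticalLocus.IsKappaCoric`)

The two Rmk-3.1.7 (i)-shaped hypotheses `hpole` / `hex` of the derivation are THEOREMS about `κ`-coric rational
functions in abc-iut-L5-t2's sense, with the order of `f` at `x ∈ Ω` read off Mathlib's normalised
numerator/denominator: `ord_x f := mult_x(f.num) − mult_x(f.denom) ∈ ℤ`. -/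

section Rmk317

open Polynomial
open scoped Classical

variable {Ω : Type u} [Field Ω]

namespace CriticalLocus

/-- The normalised numerator and denominator of a rational function have no common root (they are coprime).
[folklore] -/
private theorem not_isRoot_num_and_denom (f : RatFunc Ω) (x : Ω) : ¬ (f.num.IsRoot x ∧ f.denom.IsRoot x) := by
  rintro ⟨hn, hd⟩
  obtain ⟨a, b, hab⟩ := RatFunc.isCoprime_num_denom f
  have h := congrArg (Polynomial.eval x) hab
  simp only [eval_add, eval_mul, hn.eq_zero, hd.eq_zero, mul_zero, zero_add, eval_one] at h
  exact zero_ne_one h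

/-- A pole of `f` at `x` in divisor language (`mult_x(num) − mult_x(denom) < 0`) means `x` is a root of the
denominator. [folklore] -/
private theorem isRoot_denom_of_order_neg (f : RatFunc Ω) (x : Ω)
    (h : (f.num.rootMultiplicity x : ℤ) - (f.denom.rootMultiplicity x : ℤ) < 0) : f.denom.IsRoot x := by
  have h1 : 0 < f.denom.rootMultiplicity x := by omega
  exact (Polynomial.rootMultiplicity_pos'.mp h1).2

variable [CharZero Ω] (S : CriticalLocus Ω)

/-- **Rmk 3.1.7 (i), p. 67, divisor form of "precisely one pole"** (hypothesis `hpole` of the derivation at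
abc-iut-L5-t2's typing): a `κ`-coric rational function does NOT have poles at two distinct points — if
`f ∉ L` it "has precisely one pole [of unrestricted order]", and a constant has none.  PROVED.
([IUTchI] Rmk 3.1.7 (i) p.67) [claim: Mochizuki2012, status: disputed] -/
theorem IsKappaCoric.not_two_poles {f : RatFunc Ω} (hf : S.IsKappaCoric f) {x₁ x₂ : Ω} (hx : x₁ ≠ x₂) :
    ¬ ((f.num.rootMultiplicity x₁ : ℤ) - (f.denom.rootMultiplicity x₁ : ℤ) < 0 ∧
       (f.num.rootMultiplicity x₂ : ℤ) - (f.denom.rootMultiplicity x₂ : ℤ) < 0) := by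
  rintro ⟨h₁, h₂⟩
  have hr₁ := isRoot_denom_of_order_neg f x₁ h₁
  have hr₂ := isRoot_denom_of_order_neg f x₂ h₂
  by_cases hc : ∀ c : Ω, f ≠ RatFunc.C c
  · -- non-constant: precisely one pole
    have hcard : (poles f).card = 1 := (hf.one_pole_two_zeroes hc).1
    have hm₁ : x₁ ∈ poles f :=
      Multiset.mem_toFinset.mpr ((Polynomial.mem_roots (RatFunc.denom_ne_zero f)).mpr hr₁)
    have hm₂ : x₂ ∈ poles f :=
      Multiset.mem_toFinset.mpr ((Polynomial.mem_roots (RatFunc.denom_ne_zero f)).mpr hr₂)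
    have hlt : 1 < (poles f).card := Finset.one_lt_card.mpr ⟨x₁, hm₁, x₂, hm₂, hx⟩
    omega
  · -- constant: no pole at all
    push Not at hc
    obtain ⟨c, rfl⟩ := hc
    rw [RatFunc.denom_C] at hr₁
    exact one_ne_zero (hr₁.eq_zero.symm.trans (eval_one (x := x₁))).symm

/-- **Rmk 3.1.7 (i), p. 67, divisor form of "at least two distinct zeroes"** (hypothesis `hex` of the derivation
at abc-iut-L5-t2's typing): a NON-CONSTANT `κ`-coric rational function has positive order at two distinct points.
PROVED (its numerator has two distinct roots, at which the coprime denominator does not vanish).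
([IUTchI] Rmk 3.1.7 (i) p.67) [claim: Mochizuki2012, status: disputed] -/
theorem IsKappaCoric.exists_two_zeroes {f : RatFunc Ω} (hf : S.IsKappaCoric f) (hc : ∀ c : Ω, f ≠ RatFunc.C c) :
    ∃ x₁ x₂ : Ω, x₁ ≠ x₂ ∧
      0 < (f.num.rootMultiplicity x₁ : ℤ) - (f.denom.rootMultiplicity x₁ : ℤ) ∧
      0 < (f.num.rootMultiplicity x₂ : ℤ) - (f.denom.rootMultiplicity x₂ : ℤ) := by
  have hcard : 2 ≤ (zeroes f).card := (hf.one_pole_two_zeroes hc).2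
  obtain ⟨x₁, hm₁, x₂, hm₂, hx⟩ := Finset.one_lt_card.mp (by omega : 1 < (zeroes f).card)
  have key : ∀ x ∈ zeroes f, 0 < (f.num.rootMultiplicity x : ℤ) - (f.denom.rootMultiplicity x : ℤ) := by
    intro x hxm
    have hr : f.num.IsRoot x := (Polynomial.mem_roots'.mp (Multiset.mem_toFinset.mp hxm)).2
    have hn : 0 < f.num.rootMultiplicity x :=
      Polynomial.rootMultiplicity_pos'.mpr ⟨(Polynomial.mem_roots'.mp (Multiset.mem_toFinset.mp hxm)).1, hr⟩
    have hd : f.denom.rootMultiplicity x = 0 :=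
      Polynomial.rootMultiplicity_eq_zero fun hd => not_isRoot_num_and_denom f x ⟨hr, hd⟩
    rw [hd]
    exact_mod_cast (by omega : 0 < (f.num.rootMultiplicity x : ℤ) - 0)
  exact ⟨x₁, x₂, hx, key x₁ hm₁, key x₂ hm₂⟩

/-- **Rmk 3.1.7 (i)/(ii), p. 67: a `κ`-coric function with two distinct zeroes EXISTS** (hypothesis `hex` of the
derivation, discharged at abc-iut-L5-t2's typing under the standing hypotheses of the Remark: `Ω = L̄` algebraically
closed, strictly critical points algebraic over `ℚ`): the `κ`-coric `f_sol` of degree `4`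
(`existsKappaCoricDegreeFour_holds`) is non-constant.  PROVED. ([IUTchI] Rmk 3.1.7 (ii) p.67)
[claim: Mochizuki2012, status: disputed] -/
theorem exists_isKappaCoric_two_zeroes [IsAlgClosed Ω] (hS : ∀ e ∈ S.pts, IsAlgebraic ℚ e) :
    ∃ f : RatFunc Ω, S.IsKappaCoric f ∧ ∃ x₁ x₂ : Ω, x₁ ≠ x₂ ∧
      0 < (f.num.rootMultiplicity x₁ : ℤ) - (f.denom.rootMultiplicity x₁ : ℤ) ∧
      0 < (f.num.rootMultiplicity x₂ : ℤ) - (f.denom.rootMultiplicity x₂ : ℤ) := by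
  obtain ⟨f, hf, hdeg⟩ := S.existsKappaCoricDegreeFour_holds hS
  have hc : ∀ c : Ω, f ≠ RatFunc.C c := by
    rintro c rfl
    rw [RatFunc.num_C, natDegree_C] at hdeg
    exact absurd hdeg (by norm_num)
  exact ⟨f, hf, hf.exists_two_zeroes S hc⟩

end CriticalLocus

end Rmk317

end Literature.IUT.HodgeTheaters
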